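import Literature.MathematicalPhysics.QuantumFieldTheory.Balaban1983to89.B9Thm34GFinal

/-!
# `Balaban1983to89.B9Thm34GUniform` — [Balaban1985BackgroundPropagators] THEOREM 3.4 p. 400, THE `G(U′U)`-CLAUSE (with the
# `(Q′G′²Q′*)⁻¹(U′U)`-clause) WITH THE CONSTANTS CHOSEN BEFORE THE LATTICE: `∃ a₁ > 0 ∃ B ≧ 0 ∀ (T_η, k, {Ω_j}, U, letters) ∀ α₁ ≦ a₁ ∀ A`
# — FILE 20 `B9Thm34GFinal.thm34_G_clause_final` re-quantified; the uniformity «the constants … do not depend on the sequence {Ω_j}»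
# (p. 399) made a theorem for the `G(U′U)`-clause (FILE 46 of the Sect. B programme of cell `lit-balaban`, seat r06 gen 20)

statement-level skeleton of published theorems with citation tags; proofs where landed; nothing here is a claim about the Yang–Mills mass gap

CITATION HEADER (lean-in-tree rule).  B9 = T. Bałaban, *Propagators for lattice gauge theories in a background field*, Commun. Math. Phys.
**99** (1985) 389–434 [Balaban1985BackgroundPropagators] (held `paper:balaban1985-cmp99-background-propagators`; journal page = PDF page + 388):
Theorem 3.4 p. 400 [PDF 12] L7–10 «There exists a positive constant a₁ such that the operators G′(U), (Q′(U)G′²(U)Q′*(U))⁻¹, R(U), G(U) extend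
to configurations U′U for α₁ ≦ a₁ as analytic functions of A. The extended operators satisfy all the inequalities of Theorems 3.1–3.3
correspondingly»; Theorem 3.1 p. 397 [PDF 9] «There exist positive constants M₁, δ₀, a₀, B₀ dependent on d and L only»; Theorem 3.3 p. 399
[PDF 11] «Under the assumptions of Theorem 3.1, and with the constants described there»; p. 399 L1–3 «Let us stress that the constants in
the formulations of both theorems do not depend on the sequence {Ω_j}, j = 0, 1, …, k, if the conditions (2.1), (2.2) are satisfied»;
p. 402 [PDF 14] L23 «We assume that Theorem 3.1 is valid for the operator G′(U)»; p. 403 [PDF 15] L5–7 «of course with different constants,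
although changes are small. We define new constants in such a way that the statements of Theorem 3.1 hold for extended operators»;
p. 407 [PDF 19] (3.84)–(3.86) «for α₁ sufficiently small the series is convergent»; Thm 3.1 (3.42) p. 397, Thm 3.2 (3.48) p. 398, p. 398
remark after (3.47) «Using Lemma 2.1 in [4] we may replace the factor (Lʲη)^α by (Lʲη)^β(L^{j′}η)^γ with β + γ = α»; (3.15)/(3.19)/(3.21)/
(3.24)/(3.25) pp. 393–394; (3.57) p. 401, (3.58)–(3.65) p. 402, (3.65)bis–(3.68) p. 403; (3.76)–(3.77) pp. 405–406; (3.80)–(3.86) p. 407;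
(3.35)/(3.37) p. 396.  [4] = [Balaban1984PropagatorsII] Lemma 2.1 p. 234 [PDF 12] («For the numbers α, 0 < α < 1, c₁(α) = 12c₀(½α), and RM
satisfying (2.59)» — (2.60)–(2.61) with the absolute series c₀, c₁ and the δ₀ of (2.48): no dependence on the torus, k or {Ω_j}),
(2.51)–(2.55) p. 232, (2.61)/(2.66) p. 234.  [B11] = [Balaban1985Variational] (135) p. 298.  Rows B9.Thm3.4 × B9.Thm3.2 × B9.Thm3.3 ×
B9.Eq3.83 × B9.Eq3.62 × B9.Eq3.66 × B9.Eq3.85 (cells only; no row head changes).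

WHY THIS FILE (B9-CLOSURE §3 item 4 «Uniformity not displayed», §5 item 2 (M); FILE 20 HONEST SCOPE (iii); companion of FILE 45
`B9Thm34SectBUniform` which re-quantifies FILE 26's `G′(U′U)`- and `C⁻¹(U′U)`-clauses).  FILE 20 states the `G(U′U)`-clause as
`∀ (lattice, background, letters) ∃ a₁ ∃ B ∀ α₁ ∀ A`; the print has ONE a₁ («a positive constant a₁») and constants «dependent on d and L
only», i.e. `∃ a₁ ∃ B ∀ (lattice, …)`.  FILE 20's proof computes `a₁` (the minimum of five continuity-at-0 thresholds) and
`B = 2B₀Λ_ρ²c₁(9δ₀/50, 1/100)` from lattice-free quantities only — [4] Lemma 2.1's `c₁(d; δ₀, α)` (`B6.c1`), the p. 398 scale-transfer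
constants, `|κ|`, `M₂Σ_i‖b_i‖`, the input constants `B₀, B_G, B₁, κ_Q, c_F, C_q, a₀, C₀, κ_Qb, c_Fb, ā, δ₀` and the stencil range `d₀` —
EXCEPT that the four scale-transfer constants `Λ, Λ_ρ, Λ_ρ₁, c₄` were taken from a per-lattice hypothesis `∃ Λ ≧ 1`.  Here the p. 398 /
[4] Lemma 2.1 scale transfer is hypothesised in its printed uniform form — ONE function `Λ : (0,∞) → [1,∞)` serving every lattice of the
family — and the quantifiers are re-ordered: `a₁`, `B` FIRST, then the lattice `(S, T, 𝔅 = g, blk)`, the background `U`, the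
(3.15)/(3.19)/(3.24)/(3.60) data and Theorems 3.1/3.2/3.3 FOR `U`, then `α₁ ≦ a₁`, `A` and the `A`-dependent letters.

WHAT IS PROVED (0 `def`, 0 sorry, 0 new named facts; standard axioms).
* **`thm34_G_clause_uniform`** — FILE 20 `thm34_G_clause_final` VERBATIM in hypotheses and conclusion (`C⁻¹(U′U)` and `G(U′U)` exist as
  two-sided inverses of `Q′(U′U)G′²(U′U)Q′*(U′U)` and of the concrete `Δ_a(U′U)` of (3.82)–(3.84); every left entry `X·G(U) ≺ B₀·P·e^{−δ₀d}`
  transfers to `X·G(U′U) ≺ B·P·e^{−(δ₀/6)d}` and every right entry `G(U)·Y ≺ B₀(Lʲη)e^{−δ₀d}` to `G(U′U)·Y ≺ B(Lʲη)e^{−(δ₀/6)d}`) with the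
  quantifier order `∃ a₁ > 0 ∃ B ≧ 0 ∀ S T U g blk kQ sQ cfun w (axioms, [4] (2.61), scale transfer with the GIVEN Λ(·), commuting
  translations, unitary-type U, (3.35), stencil geometry, (3.60) data, Theorem 3.1 for G′(U), (3.19) letters + section, Theorem 3.2 for U,
  (3.15)/(3.24) letters, Theorem 3.3 for G(U)) ∀ α₁ ≦ a₁ ∀ A kF sF … ∀ (3.57)/(3.59) letters ∀ (3.80)–(3.82) letters`.  `a₁ = ½·min(ε₁,…,ε₅,
  ½)`, `B = 2B₀Λ(9/5000)²c₁(9δ₀/50, 1/100)` — FILE 20's values read at `Λ(1/100)`, `Λ(9/5000)`, `Λ(33/10000)`, `Λ(1/10)`.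

PROOF.  FILE 20's proof verbatim after the re-ordering: the four scale-transfer constants are introduced as `Λ := Λ(1/100)`,
`Λ_ρ := Λ(9/5000)`, `Λ_ρ₁ := Λ(33/10000)`, `c₄ := Λ(1/10)` BEFORE the lattice; the five threshold functions and their continuity at
`α₁ = 0` (`B9Thm34GFinal.exists_threshold_of_continuousAt`, `fun_prop`) mention no lattice datum; `0 ≦ B` by `B6RandomWalk.c1_nonneg`;
inside, the per-lattice scale transfers are the uniform ones rewritten along `Λ(1/100) = Λ` etc., and FILE 19
`B9Thm34GConcreteC.thm34_G_clause_concreteC` is applied with FILE 20's cascade, explicit constants and thresholds exactly as in FILE 20.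

HONEST SCOPE / NOT CLAIMED.  As FILE 20: Theorems 3.1–3.3 FOR `U` are inputs (p. 402); (3.37) is read blockwise in the shapes of FILES
1–19; the (3.15)/(3.19)/(3.57)/(3.59)/(3.80)–(3.81) letters are block-majorant hypotheses of the printed shape; Hölder/L² entries not
covered; the uniformity displayed is uniformity in the lattice data `(S, T, 𝔅, blk)`, the background `U`, the operators and the letters AT
FIXED input constants, direction type `κ` and algebra `(𝔸, b)` — the print's «d and L only» is this statement composed with Theorems
3.1–3.3's own uniformity (inputs here) and [4] Lemma 2.1 (`Λ(·)`, `c₁` depend on d, L, δ₀ only); the printed-kernel-form entries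
(FILES 24/25), the `R(U)`-clause (FILE 27) and the capstones (FILES 28/31) are NOT re-quantified here (same recipe: their thresholds are
the same kind of lattice-free continuity-at-0 thresholds; B9-CLOSURE §5 item 2); the rate `δ₀/6` and the exponents are ONE admissible
choice («of course with different constants», p. 403); analyticity in `A` = finite-lattice algebra; no row head changes.

RELATED IN THE TREE, NOT DUPLICATED (searched 2026-08-23: `lean search 'G_clause_uniform|GUniform' --decl` = ∅ in this block): FILE 20
`B9Thm34GFinal` (per-lattice quantifiers; §1 rescaling lemmas, `exists_threshold_of_continuousAt`, `neumann_le_two`), FILE 19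
`B9Thm34GConcreteC.thm34_G_clause_concreteC`, `B9Ineq385VG.ineq383_op` USED BY NAME; FILE 45 `B9Thm34SectBUniform` (the `G′`/`C⁻¹`
clauses) is the sibling; no existing module modified.
-/

noncomputable section

namespace Literature.MathematicalPhysics.QuantumFieldTheory.Balaban1983to89.B9Thm34GUniform

open NormedSpace Complex
open Literature.MathematicalPhysics.QuantumFieldTheory.Balaban1983to89
open Literature.MathematicalPhysics.QuantumFieldTheory.Balaban1983to89.B6RandomWalk (HasMajorant hasMajorant_mono Triangle254 Ineq261)
open Literature.MathematicalPhysics.QuantumFieldTheory.Balaban1983to89.B6RandomWalkHom (HasMajorantHom)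
open Literature.MathematicalPhysics.QuantumFieldTheory.Balaban1983to89.B9Thm34Ext (toB6)
open Literature.MathematicalPhysics.QuantumFieldTheory.Balaban1983to89.B9Ineq347 (ScaleTransfer)
open Literature.MathematicalPhysics.QuantumFieldTheory.Balaban1983to89.B9Eq386Neumann (pTwo deltaA)
open Literature.MathematicalPhysics.QuantumFieldTheory.Balaban1983to89.B9Ineq377POne (kappa377 kappa377_nonneg)
open Literature.MathematicalPhysics.QuantumFieldTheory.Balaban1983to89.B9Ineq385VG (kappa383 kappa383_nonneg kappa385 kappa385_nonneg ineq383_op)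
open Literature.MathematicalPhysics.QuantumFieldTheory.Balaban1983to89.B9Eq39Adjoint
open Literature.MathematicalPhysics.QuantumFieldTheory.Balaban1983to89.B9Eq369Small (Through)
open Literature.MathematicalPhysics.QuantumFieldTheory.Balaban1983to89.B9Eq372Locality (stBonds)
open Literature.MathematicalPhysics.QuantumFieldTheory.Balaban1983to89.B9Eq352DivForm (tauF tauB)
open Literature.MathematicalPhysics.QuantumFieldTheory.Balaban1983to89.B9Eq352DivFormLetters
open Literature.MathematicalPhysics.QuantumFieldTheory.Balaban1983to89.B9Eq352GradLetters (diffLetter)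
open Literature.MathematicalPhysics.QuantumFieldTheory.Balaban1983to89.B9Eq371GradLetters (bT bU)
open Literature.MathematicalPhysics.QuantumFieldTheory.Balaban1983to89.B9Eq372RemLetters (lapDDLetter)
open Literature.MathematicalPhysics.QuantumFieldTheory.Balaban1983to89.B9Eq382V3Letters (dPrimeLetter)
open Literature.MathematicalPhysics.QuantumFieldTheory.Balaban1983to89.B9Eq376POneLetters (conjHom gradLin divLin)
open Literature.MathematicalPhysics.QuantumFieldTheory.Balaban1983to89.B9Ineq385V3Concrete (cV385 cV385_nonneg)
open Literature.MathematicalPhysics.QuantumFieldTheory.Balaban1983to89.B9Ineq368PPrime (kappa349 kappa368)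
open Literature.MathematicalPhysics.QuantumFieldTheory.Balaban1983to89.B9Ineq368PPrimeDs (kappa368Ds kappa368Ds_nonneg kappa368_nonneg kappa349_nonneg)
open Literature.MathematicalPhysics.QuantumFieldTheory.Balaban1983to89.B9Eq360Vprime (gPrimeExtEnd)
open Literature.MathematicalPhysics.QuantumFieldTheory.Balaban1983to89.B9Eq360VprimeLetters (vPrimeConc cBConc cCConc)
open Literature.MathematicalPhysics.QuantumFieldTheory.Balaban1983to89.B9Ineq363Vprime (cVConc cVConc_nonneg theta363 thetaL363 theta363_nonneg
  thetaL363_nonneg)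
open Literature.MathematicalPhysics.QuantumFieldTheory.Balaban1983to89.B9Ineq366CPrime (kappa366 kappa366_nonneg kappa366_pos)
open Literature.MathematicalPhysics.QuantumFieldTheory.Balaban1983to89.B6RandomWalkSection (secExt secRes secConj)
open Literature.MathematicalPhysics.QuantumFieldTheory.Balaban1983to89.B9Thm34GConcreteC (thm34_G_clause_concreteC)
open Literature.MathematicalPhysics.QuantumFieldTheory.Balaban1983to89.B6RandomWalk (c1_nonneg)
open Literature.MathematicalPhysics.QuantumFieldTheory.Balaban1983to89.B9Thm34GFinal (ineq261_rescale scaleTransfer_rescale c1_pos_of_ineq261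
  exists_threshold_of_continuousAt neumann_le_two)

/-! ## Theorem 3.4, `G`-clause: `a₁`, `B` chosen before the lattice -/

section Uniform

variable {𝔸 : Type*} [NormedRing 𝔸] [NormedAlgebra ℂ 𝔸] [CompleteSpace 𝔸] {ι : Type} [Fintype ι]
variable (b : Module.Basis ι ℝ 𝔸) (κ : Type) [Fintype κ] [LinearOrder κ]

set_option maxHeartbeats 800000 in
/-- **THEOREM 3.4, `G`-CLAUSE (with the `(Q′G′²Q′*)⁻¹`-clause), CONCRETE PERTURBATION, CONSTANTS BEFORE THE LATTICE** («There exists a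
positive constant a₁ such that the operators G′(U), (Q′(U)G′²(U)Q′*(U))⁻¹, R(U), G(U) extend to configurations U′U for α₁ ≦ a₁ as analytic
functions of A. The extended operators satisfy all the inequalities of Theorems 3.1–3.3 correspondingly», p. 400; «the constants … do not
depend on the sequence {Ω_j}», p. 399; «of course with different constants», p. 403), for the `G(U′U)`-part: for fixed `d`, direction type
`κ`, algebra `(𝔸, b)` with real-coordinate constant `M₂`, input constants `δ₀, B₀, κ_Q, B_G, B₁, c_F, C_q, a₀, C₀, d₀, κ_Qb, c_Fb, ā` and ONE
scale-transfer function `Λ(·) ≧ 1` (p. 398 / [4] Lemma 2.1), `∃ a₁ > 0 ∃ B ≧ 0` such that FOR EVERY lattice `(S, T)`, geometry `𝔅 = g`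
with block map `blk`, background `U`, (3.15)/(3.19)/(3.24)/(3.60) data and operators `G′(U)`, `C⁻¹(U)`, `G(U)` obeying Theorems 3.1–3.3 at
the rate `δ₀` (FILE 20's hypotheses verbatim, the scale transfer with the given `Λ(α)`), for all `0 ≦ α₁ ≦ a₁`, `A` in (3.37) (blockwise),
`∀` (3.57)/(3.59)/(3.80)–(3.81) letters of size `O(1)α₁`: `C⁻¹(U′U)` and `G(U′U)` exist (two-sided inverses of `Q′(U′U)G′²(U′U)Q′*(U′U)`
and of the concrete `Δ_a(U′U)` of (3.82)–(3.84)) and every left/right (3.42)-entry of Theorem 3.3 transfers from `G(U)` at `(B₀, δ₀)` to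
`G(U′U)` at `(B, δ₀/6)`.  (`a₁`, `B` = FILE 20's values read at `Λ(1/100)`, `Λ(9/5000)`, `Λ(33/10000)`, `Λ(1/10)`.)
[cite: Balaban1985BackgroundPropagators, Thm 3.4 p.400 + p.399 + p.402 + p.403 + p.407 + Thm 3.1 (3.42) p.397 + Thm 3.2 (3.48) p.398 + Thm 3.3 p.399 + p.398 remark + (3.15)/(3.19)/(3.21)/(3.24)/(3.25) pp.393–394 + (3.57) p.401 + (3.58)–(3.65) p.402 + (3.65)bis–(3.67) p.403 + (3.68) p.403 + (3.76)–(3.77) pp.405–406 + (3.80)–(3.86) p.407 + (3.35)/(3.37) p.396; Balaban1984PropagatorsII, Lemma 2.1 p.234 + (2.51)–(2.55) p.232 + (2.66) p.234; Balaban1985Variational, (135) p.298] -/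
theorem thm34_G_clause_uniform [DecidableEq ι] (d : ℕ)
    (δ₀ B₀ κQ BG B₁ cF Cq a₀ C₀ d₀ M₂ κQb cFb abar : ℝ) (Λf : ℝ → ℝ)
    (hB₀ : 0 ≤ B₀) (hκQ : 0 < κQ) (hBG : 0 < BG) (hB₁ : 0 < B₁) (hcF : 0 < cF) (hCq : 0 ≤ Cq) (ha₀ : 0 ≤ a₀) (hC₀ : 0 ≤ C₀)
    (hM₂ : 0 ≤ M₂) (hδ₀ : 0 < δ₀) (hκQb : 0 ≤ κQb) (hcFb : 0 ≤ cFb) (habar : 0 ≤ abar) (hΛf : ∀ α : ℝ, 0 < α → 1 ≤ Λf α)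
    (hrepr : ∀ (v : 𝔸) (i : ι), |b.repr v i| ≤ M₂ * ‖v‖) :
    ∃ a₁ : ℝ, 0 < a₁ ∧ ∃ B : ℝ, 0 ≤ B ∧
    ∀ {S : Type} [Fintype S] [DecidableEq S] (T : κ → Equiv.Perm S) (U : κ → S → 𝔸ˣ)
      {g : B9.Geometry} [Fintype g.Site] [DecidableEq g.Site] [Nonempty g.Site] {Rr : ℝ} {H : Prop} (blk : S → g.Site)
      (kQ : g.Site → S → 𝔸 →L[ℝ] 𝔸) (sQ : S → 𝔸 →L[ℝ] 𝔸) (cfun w : g.Site → ℝ)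
    -- the multiscale geometry 𝔅 (p. 393, [4] (2.1)–(2.4)) and its axioms
    (hdnn : ∀ a a' : g.Site, 0 ≤ g.dist a a') (htri : Triangle254 (toB6 g Rr H)) (hrefl : ∀ y : g.Site, g.dist y y = 0)
    (hsym : ∀ y y' : g.Site, g.dist y y' = g.dist y' y) (hlen : ∀ y : g.Site, 0 < g.len y) (hlenη : ∀ y : g.Site, g.eta ≤ g.len y)
    (hη : 0 < g.eta) (hL : 1 ≤ g.L)
    -- [4] Lemma 2.1 (2.61) at the rate `δ₀`, «for every 0 < α < 1»
    (h261 : ∀ α : ℝ, 0 < α → α < 1 → Ineq261 d (toB6 g Rr H) δ₀ α)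
    -- p. 398: «Using Lemma 2.1 in [4] we may replace the factor (Lʲη)^α by (Lʲη)^β(L^{j′}η)^γ with β + γ = α» — for every exponent, one
    -- constant `Λ(α) ≧ 1` for the six weights `(Lʲη)^{1,2,−1,−2,−4}` (natural and real powers)
      (hST : ∀ α : ℝ, 0 < α → ScaleTransfer g δ₀ α (Λf α) (fun a => g.len a) ∧ ScaleTransfer g δ₀ α (Λf α) (fun a => g.len a ^ 2) ∧
        ScaleTransfer g δ₀ α (Λf α) (fun a => (g.len a)⁻¹) ∧ ScaleTransfer g δ₀ α (Λf α) (fun a => (g.len a ^ 2)⁻¹) ∧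
        ScaleTransfer g δ₀ α (Λf α) (fun a => (g.len a ^ 4)⁻¹) ∧ ScaleTransfer g δ₀ α (Λf α) (fun y => g.len y ^ (-(4 : ℝ))))
    -- real coordinates of `𝔸`, commuting translations, unitary-type background
    (hT : ∀ (μ ν : κ) (x : S), T μ (T ν x) = T ν (T μ x))
    (hU1 : ∀ m z, ‖((U m z : 𝔸ˣ) : 𝔸)‖ ≤ 1 ∧ ‖(((U m z)⁻¹ : 𝔸ˣ) : 𝔸)‖ ≤ 1)
    -- (3.35) on the plaquettes through each bond, at that bond's block scale; stencil geometry at range `d₀`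
    (h35 : ∀ μ x m n y, Through T μ x m n y → ‖(plaqU T U m n y : 𝔸) - 1‖ ≤ C₀ * ((g.L ^ g.scale (blk x))⁻¹) ^ 2)
    (hd₀B : ∀ μ x, g.dist (blk x) (blk ((T μ).symm x)) ≤ d₀) (hd₀F : ∀ μ x, g.dist (blk x) (blk (T μ x)) ≤ d₀)
    (hd₀FB : ∀ μ ν x, g.dist (blk x) (blk ((T ν).symm (T μ x))) ≤ d₀)
    (hd₀st : ∀ μ x (q : κ × S), q ∈ stBonds T μ x → g.dist (blk x) (blk q.2) ≤ d₀)
    (hd₀loc : ∀ μ x (q : κ × S), q ∈ B9Eq375Locality.locBondsA' T μ x → g.dist (blk x) (blk q.2) ≤ d₀)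
    (hd₀0 : ∀ y : g.Site, g.dist y y ≤ d₀)
    -- the `A`-independent data of the concrete `V′(A)` of (3.60): (3.19) kernels/multipliers and the `a`-weights of (3.24)
    (hw : ∀ y, 0 ≤ w y) (hcard : ∀ y, ((B9Eq360Vprime.block blk y).card : ℝ) * w y ≤ 1)
    (hkQ : ∀ y x, blk x = y → ‖kQ y x‖ ≤ w y) (hsQ : ∀ x, ‖sQ x‖ ≤ 1) (hcfun : ∀ y, |cfun y| ≤ a₀ * (g.len y ^ 2)⁻¹)
    -- THEOREM 3.1 for `G′(U)`: (3.42)₁,₂,₃ at the rate `δ₀`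
    {Gp : Module.End ℝ (S × ι → ℝ)}
    (h342_1 : HasMajorant (g := toB6 g Rr H) (fun p : S × ι => blk p.1) Gp
      (fun a a' => BG * g.len a ^ 2 * Real.exp (-(δ₀ * g.dist a a'))))
    (h342_2 : ∀ k : κ ⊕ κ, HasMajorant (g := toB6 g Rr H) (fun p : S × ι => blk p.1)
      (conj b (diffLetter T U ((g.eta : ℂ)⁻¹) k) * Gp) (fun a a' => BG * g.len a * Real.exp (-(δ₀ * g.dist a a'))))
    (h342_3 : ∀ k : κ ⊕ κ, HasMajorant (g := toB6 g Rr H) (fun p : S × ι => blk p.1)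
      (Gp * conj b (diffLetter T U ((g.eta : ℂ)⁻¹) k)) (fun a a' => BG * g.len a * Real.exp (-(δ₀ * g.dist a a'))))
    -- the (3.19) letters `Q′(U)`, `Q′*(U)` in their own typing with block-local two-space majorants, a section of the block map (FILE 17)
    (rep : g.Site → S × ι) (hrep : ∀ y : g.Site, blk (rep y).1 = y)
    {Qc : (S × ι → ℝ) →ₗ[ℝ] (g.Site → ℝ)} {Qcs : (g.Site → ℝ) →ₗ[ℝ] (S × ι → ℝ)} {Linv : Module.End ℝ (g.Site → ℝ)}
    (hQc : HasMajorantHom (g := toB6 g Rr H) (fun p : S × ι => blk p.1) (fun y : g.Site => y) Qc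
      (fun a a' : g.Site => κQ * (if a = a' then (1 : ℝ) else 0)))
    (hQcs : HasMajorantHom (g := toB6 g Rr H) (fun y : g.Site => y) (fun p : S × ι => blk p.1) Qcs
      (fun a a' : g.Site => κQ * (if a = a' then (1 : ℝ) else 0)))
    -- THEOREM 3.2 for `U`: (3.21) `C⁻¹ = (Q′G′²Q′*)⁻¹` exists (`hLinv`) with the KERNEL bound (3.48) at the rate `δ₀`
    (hLinv : (Qc ∘ₗ (Gp * Gp) ∘ₗ Qcs) * Linv = 1)
    (h348 : ∀ y y' : g.Site, |B9Thm34Inv.ker (B9Thm34Inv.vol g d) Linv y y'| ≤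
      B₁ * g.len y ^ (-(4 : ℝ)) * g.len y' ^ (-(d : ℝ)) * Real.exp (-(δ₀ * g.dist y y')))
    -- the (3.15) bond letters `Q(U)`, `Q*(U)` and the weight letter `a` of (3.24)/(3.26), with their majorants
    {G Qs Q a : Module.End ℝ ((κ × S) × ι → ℝ)}
    (hQb : HasMajorant (g := toB6 g Rr H) (fun q : (κ × S) × ι => blk q.1.2) Q (fun a a' => κQb * Real.exp (-(δ₀ * g.dist a a'))))
    (hQsb : HasMajorant (g := toB6 g Rr H) (fun q : (κ × S) × ι => blk q.1.2) Qs (fun a a' => κQb * Real.exp (-(δ₀ * g.dist a a'))))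
    (ha324 : HasMajorant (g := toB6 g Rr H) (fun q : (κ × S) × ι => blk q.1.2) a
      (fun a a' : g.Site => if a = a' then abar * (g.len a ^ 2)⁻¹ else 0))
    -- THEOREM 3.3 for `G(U)`: two-sided inverse of the concrete `Δ_a(U)` and its (3.42)-entries at the rate `δ₀`
    (hΔG : deltaA (conj b (lapDDLetter T ((g.eta : ℂ)⁻¹) U)) (conj b (dPrimeLetter T U g.eta))
      (conjHom b (gradLin T ((g.eta : ℂ)⁻¹) U) ∘ₗ (1 - (Gp ∘ₗ Qcs ∘ₗ Linv ∘ₗ Qc ∘ₗ Gp)) ∘ₗ conjHom b (divLin T ((g.eta : ℂ)⁻¹) U)) Qs a Q * G = 1)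
    (hGΔ : G * deltaA (conj b (lapDDLetter T ((g.eta : ℂ)⁻¹) U)) (conj b (dPrimeLetter T U g.eta))
      (conjHom b (gradLin T ((g.eta : ℂ)⁻¹) U) ∘ₗ (1 - (Gp ∘ₗ Qcs ∘ₗ Linv ∘ₗ Qc ∘ₗ Gp)) ∘ₗ conjHom b (divLin T ((g.eta : ℂ)⁻¹) U)) Qs a Q = 1)
    (hG : HasMajorant (g := toB6 g Rr H) (fun q : (κ × S) × ι => blk q.1.2) G
      (fun a a' => B₀ * g.len a ^ 2 * Real.exp (-(δ₀ * g.dist a a'))))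
    (hDG : ∀ k : κ ⊕ κ, HasMajorant (g := toB6 g Rr H) (fun q : (κ × S) × ι => blk q.1.2)
      (conj b (diffLetter (bT T) (bU U) ((g.eta : ℂ)⁻¹) k) * G) (fun a a' => B₀ * g.len a * Real.exp (-(δ₀ * g.dist a a'))))
    (hGD : ∀ k : κ ⊕ κ, HasMajorant (g := toB6 g Rr H) (fun q : (κ × S) × ι => blk q.1.2)
      (G * conj b (diffLetter (bT T) (bU U) ((g.eta : ℂ)⁻¹) k)) (fun a a' => B₀ * g.len a * Real.exp (-(δ₀ * g.dist a a')))),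
    ∀ (α₁ : ℝ), 0 ≤ α₁ → α₁ ≤ a₁ →
    -- the exponent field `A` in the domain (3.37), read blockwise in the shapes of FILES 1–19, and the `A`-dependent (3.59) data `kF`, `sF`
    ∀ (A : κ → S → 𝔸) (kF : g.Site → S → 𝔸 →L[ℝ] 𝔸) (sF : S → 𝔸 →L[ℝ] 𝔸),
      (∀ y x, blk x = y → ‖kF y x‖ ≤ Cq * α₁ * w y) → (∀ x, ‖sF x‖ ≤ Cq * α₁) →
      (∀ ν k x, ‖((g.eta : ℂ)⁻¹) • covDstar T U ν (A k) x‖ ≤ α₁ * (g.len (blk x) ^ 2)⁻¹) →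
      (∀ μ ν x, ‖((g.eta : ℂ)⁻¹) • covD T U μ (A ν) x‖ ≤ α₁ * (g.len (blk x) ^ 2)⁻¹) →
      (∀ μ ν x, ‖((g.eta : ℂ)⁻¹) • covDstar T U ν (A ν) (T μ x)‖ ≤ α₁ * (g.len (blk x) ^ 2)⁻¹) →
      (∀ μ x, ‖((g.eta : ℂ)⁻¹) • covDstar T U μ (tauB T U μ (A μ)) x‖ ≤ α₁ * (g.len (blk x) ^ 2)⁻¹) →
      (∀ μ ν k x, ‖((g.eta : ℂ)⁻¹) • covD T U μ (A k) ((T ν).symm x)‖ ≤ α₁ * (g.len (blk x) ^ 2)⁻¹) →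
      (∀ k x, ‖A k x‖ ≤ α₁ * (g.len (blk x))⁻¹) → (∀ ν k x, ‖tauB T U ν (A k) x‖ ≤ α₁ * (g.len (blk x))⁻¹) →
      (∀ μ k x, ‖tauF T U μ (A k) x‖ ≤ α₁ * (g.len (blk x))⁻¹) →
      (∀ k μ ν x, ‖A k ((T ν).symm (T μ x))‖ ≤ α₁ * (g.len (blk x))⁻¹) →
      (∀ μ x m z, (m, z) ∈ stBonds T μ x → ‖A m z‖ ≤ α₁ * (g.len (blk x))⁻¹) →
      (∀ μ x m z, (m, z) ∈ B9Eq375Locality.locBondsA T μ x → ‖A m z‖ ≤ α₁ * (g.len (blk x))⁻¹) →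
      (∀ μ x m n y, Through T μ x m n y →
        ‖covD T U m (A n) y‖ ≤ g.eta * (α₁ * ((g.len (blk x))⁻¹) ^ 2) ∧ ‖covD T U n (A m) y‖ ≤ g.eta * (α₁ * ((g.len (blk x))⁻¹) ^ 2)) →
    -- the (3.57)/(3.59) letters `F′₂(A)`, `F′₂*(A)` (block-local, size `c_F α₁`)
    ∀ {Qc' Fc : (S × ι → ℝ) →ₗ[ℝ] (g.Site → ℝ)} {Qcs' Fcs : (g.Site → ℝ) →ₗ[ℝ] (S × ι → ℝ)},
      Qc' = Qc + Fc → Qcs' = Qcs + Fcs →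
      HasMajorantHom (g := toB6 g Rr H) (fun p : S × ι => blk p.1) (fun y : g.Site => y) Fc
        (fun a a' : g.Site => cF * α₁ * (if a = a' then (1 : ℝ) else 0)) →
      HasMajorantHom (g := toB6 g Rr H) (fun y : g.Site => y) (fun p : S × ι => blk p.1) Fcs
        (fun a a' : g.Site => cF * α₁ * (if a = a' then (1 : ℝ) else 0)) →
    -- the (3.80)–(3.81) letters `F₂(A)`, `F₂*(A)` («|F₂(A)|, |F₂*(A)| ≦ O(1)α₁»), `P₂(A)` of (3.82)
    ∀ {P₂ Qs' Q' F₂ F₂s : Module.End ℝ ((κ × S) × ι → ℝ)},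
      Q' = Q + F₂ → Qs' = Qs + F₂s → P₂ = pTwo Qs Q F₂ F₂s a →
      HasMajorant (g := toB6 g Rr H) (fun q : (κ × S) × ι => blk q.1.2) F₂ (fun a a' => cFb * α₁ * Real.exp (-(δ₀ * g.dist a a'))) →
      HasMajorant (g := toB6 g Rr H) (fun q : (κ × S) × ι => blk q.1.2) F₂s (fun a a' => cFb * α₁ * Real.exp (-(δ₀ * g.dist a a'))) →
    ∃ (Tinv : Module.End ℝ (g.Site → ℝ)) (GExt : Module.End ℝ ((κ × S) × ι → ℝ)),
      Tinv * (Qc' ∘ₗ ((gPrimeExtEnd Gp (conj b (vPrimeConc T U g.eta A blk kQ kF sQ sF cfun) * Gp)) * (gPrimeExtEnd Gp (conj b (vPrimeConc T U g.eta A blk kQ kF sQ sF cfun) * Gp))) ∘ₗ Qcs') = 1 ∧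
      (Qc' ∘ₗ ((gPrimeExtEnd Gp (conj b (vPrimeConc T U g.eta A blk kQ kF sQ sF cfun) * Gp)) * (gPrimeExtEnd Gp (conj b (vPrimeConc T U g.eta A blk kQ kF sQ sF cfun) * Gp))) ∘ₗ Qcs') * Tinv = 1 ∧
      deltaA (conj b (lapDDLetter T ((g.eta : ℂ)⁻¹) (prodCfg U g.eta A)))
          (conj b (dPrimeLetter T (prodCfg U g.eta A) g.eta))
          (conjHom b (gradLin T ((g.eta : ℂ)⁻¹) (prodCfg U g.eta A)) ∘ₗ (1 - ((Gp ∘ₗ Qcs ∘ₗ Linv ∘ₗ Qc ∘ₗ Gp) + (B9Eq360Vprime.pPrime Gp (gPrimeExtEnd Gp (conj b (vPrimeConc T U g.eta A blk kQ kF sQ sF cfun) * Gp)) (Qcs ∘ₗ secRes rep) (Qcs' ∘ₗ secRes rep) (secConj rep Linv) (secConj rep Tinv) (secExt rep ∘ₗ Qc) (secExt rep ∘ₗ Qc'))))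
            ∘ₗ conjHom b (divLin T ((g.eta : ℂ)⁻¹) (prodCfg U g.eta A))) Qs' a Q' * GExt = 1 ∧
      GExt *
      deltaA (conj b (lapDDLetter T ((g.eta : ℂ)⁻¹) (prodCfg U g.eta A)))
          (conj b (dPrimeLetter T (prodCfg U g.eta A) g.eta))
          (conjHom b (gradLin T ((g.eta : ℂ)⁻¹) (prodCfg U g.eta A)) ∘ₗ (1 - ((Gp ∘ₗ Qcs ∘ₗ Linv ∘ₗ Qc ∘ₗ Gp) + (B9Eq360Vprime.pPrime Gp (gPrimeExtEnd Gp (conj b (vPrimeConc T U g.eta A blk kQ kF sQ sF cfun) * Gp)) (Qcs ∘ₗ secRes rep) (Qcs' ∘ₗ secRes rep) (secConj rep Linv) (secConj rep Tinv) (secExt rep ∘ₗ Qc) (secExt rep ∘ₗ Qc'))))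
            ∘ₗ conjHom b (divLin T ((g.eta : ℂ)⁻¹) (prodCfg U g.eta A))) Qs' a Q' = 1 ∧
      (∀ (X : Module.End ℝ ((κ × S) × ι → ℝ)) (P : g.Site → ℝ), (∀ y, 0 ≤ P y) →
        HasMajorant (g := toB6 g Rr H) (fun q : (κ × S) × ι => blk q.1.2) (X * G)
          (fun a a' => B₀ * P a * Real.exp (-(δ₀ * g.dist a a'))) →
        HasMajorant (g := toB6 g Rr H) (fun q : (κ × S) × ι => blk q.1.2) (X * GExt)
          (fun a a' => B * P a * Real.exp (-(δ₀ / 6 * g.dist a a')))) ∧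
      (∀ Y : Module.End ℝ ((κ × S) × ι → ℝ),
        HasMajorant (g := toB6 g Rr H) (fun q : (κ × S) × ι => blk q.1.2) (G * Y)
          (fun a a' => B₀ * g.len a * Real.exp (-(δ₀ * g.dist a a'))) →
        HasMajorant (g := toB6 g Rr H) (fun q : (κ × S) × ι => blk q.1.2) (GExt * Y)
          (fun a a' => B * g.len a * Real.exp (-(δ₀ / 6 * g.dist a a')))) := by
  classical
  have hSb : 0 ≤ ∑ i, ‖b i‖ := Finset.sum_nonneg fun i _ => norm_nonneg _
  -- the four scale-transfer constants of the cascade, READ FROM THE GIVEN FUNCTION `Λ(·)` (lattice-free), under the names of FILE 20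
  obtain ⟨Λ, hΛ, hΛeq⟩ : ∃ Λ : ℝ, 1 ≤ Λ ∧ Λf (1 / 100) = Λ := ⟨_, hΛf _ (by norm_num), rfl⟩
  obtain ⟨Λρ, hΛρ1, hΛρeq⟩ : ∃ Λρ : ℝ, 1 ≤ Λρ ∧ Λf (1 / 100 * (9 / 50)) = Λρ := ⟨_, hΛf _ (by norm_num), rfl⟩
  obtain ⟨Λρ₁, hΛρ₁1, hΛρ₁eq⟩ : ∃ Λρ₁ : ℝ, 1 ≤ Λρ₁ ∧ Λf (1 / 100 * (33 / 100)) = Λρ₁ := ⟨_, hΛf _ (by norm_num), rfl⟩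
  obtain ⟨c₄, hc₄1, hc₄eq⟩ : ∃ c₄ : ℝ, 1 ≤ c₄ ∧ Λf (1 / 10) = c₄ := ⟨_, hΛf _ (by norm_num), rfl⟩
  have hΛ0 : 0 < Λ := zero_lt_one.trans_le hΛ
  have hΛρ : 0 ≤ Λρ := zero_le_one.trans hΛρ1
  have hΛρ₁ : 0 ≤ Λρ₁ := zero_le_one.trans hΛρ₁1
  have hc₄ : 0 < c₄ := zero_lt_one.trans_le hc₄1
  have hBnn : 0 ≤ 2 * B₀ * Λρ ^ 2 * B6.c1 d (9 / 50 * δ₀) (1 / 100) := mul_nonneg (mul_nonneg (mul_nonneg zero_le_two hB₀) (sq_nonneg Λρ)) (c1_nonneg _ _ _)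
  -- «for α₁ sufficiently small» (pp. 402, 403, 407): the five threshold functions of FILES 1–19 are CONTINUOUS AT `α₁ = 0` and vanish there — NO lattice datum enters
  obtain ⟨ε₁, hε₁, hF1⟩ := exists_threshold_of_continuousAt
    (f := fun α₁ : ℝ => theta363 (Fintype.card κ) 1 α₁ a₀ Cq M₂ (∑ i, ‖b i‖) (Real.exp (δ₀ * d₀)) BG Λ (B6.c1 d δ₀ (1 / 100)) * B6.c1 d (49 / 50 * δ₀) (1 / 100))
    (by unfold theta363 kappa385 cVConc cBConc; fun_prop) (by simp [theta363])
  obtain ⟨ε₂, hε₂, hF2⟩ := exists_threshold_of_continuousAt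
    (f := fun α₁ : ℝ => theta363 (Fintype.card κ) 1 α₁ a₀ Cq M₂ (∑ i, ‖b i‖) (Real.exp (7 / 20 * δ₀ * d₀)) BG Λ (B6.c1 d δ₀ (1 / 100)) * B6.c1 d (33 / 100 * δ₀) (1 / 100))
    (by unfold theta363 kappa385 cVConc cBConc; fun_prop) (by simp [theta363])
  obtain ⟨ε₃, hε₃, hF3⟩ := exists_threshold_of_continuousAt
    (f := fun α₁ : ℝ => thetaL363 (Fintype.card κ) 1 α₁ a₀ Cq M₂ (∑ i, ‖b i‖) (Real.exp (7 / 20 * δ₀ * d₀)) BG Λ (B6.c1 d δ₀ (1 / 100)) * B6.c1 d (33 / 100 * δ₀) (1 / 100))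
    (by unfold thetaL363 kappa385 cVConc cBConc; fun_prop) (by simp [thetaL363])
  obtain ⟨ε₄, hε₄, hF4⟩ := exists_threshold_of_continuousAt
    (f := fun α₁ : ℝ => kappa385 B₀ (cV385 (Fintype.card κ) α₁ C₀ ((M₂ * ∑ i, ‖b i‖) * Real.exp (1 / 5 * δ₀ * d₀)) + ∑ _k : κ ⊕ κ, (10 + 8 * ↑(Fintype.card κ) + (16 * ↑(Fintype.card κ) + 12) * C₀) * ((M₂ * ∑ i, ‖b i‖) * Real.exp (1 / 5 * δ₀ * d₀))) (kappa377 (4 * (1 + ↑(Fintype.card κ)) * (M₂ * ∑ i, ‖b i‖) * Real.exp (1 / 4 * δ₀ * d₀)) (kappa349 κQ ((1 + ↑(Fintype.card κ)) * BG) B₁ Λ (B6.c1 d δ₀ (1 / 100))) (kappa368 κQ cF (kappa385 1 (cVConc (Fintype.card κ) 1 α₁ a₀ Cq M₂ (∑ i, ‖b i‖) (Real.exp (7 / 20 * δ₀ * d₀))) 0 0 Λ (B6.c1 d δ₀ (1 / 100))) (kappa366 κQ cF (kappa385 1 (cVConc (Fintype.card κ) 1 α₁ a₀ Cq M₂ (∑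 i, ‖b i‖) (Real.exp (δ₀ * d₀))) 0 0 Λ (B6.c1 d δ₀ (1 / 100))) BG (BG * B6.c1 d (49 / 50 * δ₀) (1 / 100) * (1 - theta363 (Fintype.card κ) 1 α₁ a₀ Cq M₂ (∑ i, ‖b i‖) (Real.exp (δ₀ * d₀)) BG Λ (B6.c1 d δ₀ (1 / 100)) * B6.c1 d (49 / 50 * δ₀) (1 / 100))⁻¹) Λ (B6.c1 d δ₀ (1 / 100)) α₁) BG BG (BG * B6.c1 d (33 / 100 * δ₀) (1 / 100) * (1 - theta363 (Fintype.card κ) 1 α₁ a₀ Cq M₂ (∑ i, ‖b i‖) (Real.exp (7 / 20 * δ₀ * d₀)) BG Λ (B6.c1 d δ₀ (1 / 100)) * B6.c1 d (33 / 100 * δ₀) (1 / 100))⁻¹) B₁ (2 * B₁ * B6.c1 d ((1 / 2 - 1 / 10) * δ₀) (1 / 10)) Λ (B6.c1 d δ₀ (1 / 100)) α₁ + ↑(Fintype.card κ) * kappa368Ds κQ cF (kappa385 BG (cVConc (Fintype.card κ) 1 α₁ a₀ Cq M₂ (∑ i, ‖b i‖) (Real.exp (7 / 20 * δ₀ * d₀)))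 0 0 Λ (B6.c1 d δ₀ (1 / 100))) (kappa366 κQ cF (kappa385 1 (cVConc (Fintype.card κ) 1 α₁ a₀ Cq M₂ (∑ i, ‖b i‖) (Real.exp (δ₀ * d₀))) 0 0 Λ (B6.c1 d δ₀ (1 / 100))) BG (BG * B6.c1 d (49 / 50 * δ₀) (1 / 100) * (1 - theta363 (Fintype.card κ) 1 α₁ a₀ Cq M₂ (∑ i, ‖b i‖) (Real.exp (δ₀ * d₀)) BG Λ (B6.c1 d δ₀ (1 / 100)) * B6.c1 d (49 / 50 * δ₀) (1 / 100))⁻¹) Λ (B6.c1 d δ₀ (1 / 100)) α₁) BG BG BG (B6.c1 d (33 / 100 * δ₀) (1 / 100) * (1 - theta363 (Fintype.card κ) 1 α₁ a₀ Cq M₂ (∑ i, ‖b i‖) (Real.exp (7 / 20 * δ₀ * d₀)) BG Λ (B6.c1 d δ₀ (1 / 100)) * B6.c1 d (33 / 100 * δ₀) (1 / 100))⁻¹) (BG * Λρ₁ ^ 2 * B6.c1 d (33 / 100 * δ₀) (1 / 100) * (1 - thetaL363 (Fintype.card κ) 1 α₁ a₀ Cq M₂ (∑ i, ‖b i‖)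 (Real.exp (7 / 20 * δ₀ * d₀)) BG Λ (B6.c1 d δ₀ (1 / 100)) * B6.c1 d (33 / 100 * δ₀) (1 / 100))⁻¹) B₁ (2 * B₁ * B6.c1 d ((1 / 2 - 1 / 10) * δ₀) (1 / 10)) (cBConc (Fintype.card κ) M₂ (∑ i, ‖b i‖) (Real.exp (B9Ineq368Vprime.rateC (1 / 100) (33 / 100 * δ₀) * d₀))) (cCConc (Fintype.card κ) 1 α₁ a₀ Cq M₂ (∑ i, ‖b i‖) (Real.exp (B9Ineq368Vprime.rateC (1 / 100) (33 / 100 * δ₀) * d₀))) Λ (B6.c1 d δ₀ (1 / 100)) α₁) Λ (B6.c1 d δ₀ (1 / 100)) α₁) (kappa383 κQb cFb abar Λ (B6.c1 d δ₀ (1 / 100)) α₁) Λ (B6.c1 d δ₀ (1 / 100)) * α₁ * B6.c1 d (9 / 50 * δ₀) (1 / 100))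
    (by
      unfold theta363 thetaL363 kappa368 kappa368Ds kappa377 kappa366 kappa349 kappa383 kappa385 cV385 B9Eq382V3Letters.cV0
        B9Eq373V3.kΔ B9Eq373V3.kP cCConc cVConc cBConc
      fun_prop (disch := simp))
    (by simp)
  obtain ⟨ε₅, hε₅, hF5⟩ := exists_threshold_of_continuousAt
    (f := fun α₁ : ℝ => α₁ * (2 * (kappa366 κQ cF (kappa385 1 (cVConc (Fintype.card κ) 1 α₁ a₀ Cq M₂ (∑ i, ‖b i‖) (Real.exp (δ₀ * d₀))) 0 0 Λ (B6.c1 d δ₀ (1 / 100))) BG (BG * B6.c1 d (49 / 50 * δ₀) (1 / 100) * (1 - theta363 (Fintype.card κ) 1 α₁ a₀ Cq M₂ (∑ i, ‖b i‖) (Real.exp (δ₀ * d₀)) BG Λ (B6.c1 d δ₀ (1 / 100)) * B6.c1 d (49 / 50 * δ₀) (1 / 100))⁻¹) Λ (B6.c1 d δ₀ (1 / 100)) α₁ * B₁ * c₄ * B6.c1 d δ₀ (1 / 2 + 1 / 10)) * B6.c1 d ((1 / 2 - 1 / 10) * δ₀) (1 / 10)))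
    (by
      unfold theta363 kappa366 kappa385 cVConc cBConc
      fun_prop (disch := simp))
    (by simp)
  -- the threshold `a₁` and the `α₁`-independent constant `B`
  refine ⟨min (min (min ε₁ ε₂) (min ε₃ ε₄)) (min ε₅ (1 / 2)) / 2,
    half_pos (lt_min (lt_min (lt_min hε₁ hε₂) (lt_min hε₃ hε₄)) (lt_min hε₅ one_half_pos)), 2 * B₀ * Λρ ^ 2 * B6.c1 d (9 / 50 * δ₀) (1 / 100),
    hBnn, ?_⟩
  -- NOW the lattice, the background, the letters and Theorems 3.1–3.3 for `U`
  intro S _ _ T U g _ _ _ Rr H blk kQ sQ cfun w hdnn htri hrefl hsym hlen hlenη hη hL h261 hST hT hU1 h35 hd₀B hd₀F hd₀FB hd₀st hd₀loc hd₀0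
    hw hcard hkQ hsQ hcfun Gp h342_1 h342_2 h342_3 rep hrep Qc Qcs Linv hQc hQcs hLinv h348 G Qs Q a hQb hQsb ha324 hΔG hGΔ hG hDG hGD
    α₁ hα₁0 hα₁1 A kF sF hkF hsF h337B h337F h337B' h337Bτ h337FB hA hAτB hAτF hAFB hAst hAloc hdAst Qc' Fc Qcs' Fcs h357 h357s hFc hFcs P₂ Qs' Q' F₂ F₂s h380 h380s hP₂def hF₂ hF₂s
  obtain ⟨y₀⟩ := ‹Nonempty g.Site›
  -- the p. 398 scale transfers at the exponents of the cascade, for THIS lattice, from the uniform hypothesis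
  obtain ⟨hT1, hT2, hT1i, hT2i, hT4, -⟩ := hST (1 / 100) (by norm_num)
  obtain ⟨hTρ0, -, -, -, -, -⟩ := hST (1 / 100 * (9 / 50)) (by norm_num)
  obtain ⟨hTρ₁0, -, -, -, -, -⟩ := hST (1 / 100 * (33 / 100)) (by norm_num)
  obtain ⟨-, -, -, -, -, hT4v⟩ := hST (1 / 10) (by norm_num)
  rw [hΛeq] at hT1 hT2 hT1i hT2i hT4
  rw [hΛρeq] at hTρ0
  rw [hΛρ₁eq] at hTρ₁0
  rw [hc₄eq] at hT4v
  have hTρ : ScaleTransfer g (9 / 50 * δ₀) (1 / 100) Λρ (fun a => g.len a) := scaleTransfer_rescale hTρ0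
  have hTρ₁ : ScaleTransfer g (33 / 100 * δ₀) (1 / 100) Λρ₁ (fun a => g.len a) := scaleTransfer_rescale hTρ₁0
  -- [4] Lemma 2.1 at the six (rate, exponent) pairs of the cascade, all read from the one printed rate `δ₀` (§1)
  have h261β : Ineq261 d (toB6 g Rr H) δ₀ (1 / 100) := h261 _ (by norm_num) (by norm_num)
  have h261' : Ineq261 d (toB6 g Rr H) (9 / 50 * δ₀) (1 / 100) :=
    ineq261_rescale (h261 (1 / 100 * (9 / 50)) (by norm_num) (by norm_num))
  have h261'' : Ineq261 d (toB6 g Rr H) (33 / 100 * δ₀) (1 / 100) :=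
    ineq261_rescale (h261 (1 / 100 * (33 / 100)) (by norm_num) (by norm_num))
  have h261c : Ineq261 d (toB6 g Rr H) (49 / 50 * δ₀) (1 / 100) :=
    ineq261_rescale (h261 (1 / 100 * (49 / 50)) (by norm_num) (by norm_num))
  have h261v : Ineq261 d (toB6 g Rr H) δ₀ (1 / 2 + 1 / 10) := h261 _ (by norm_num) (by norm_num)
  have h261v' : Ineq261 d (toB6 g Rr H) ((1 / 2 - 1 / 10) * δ₀) (1 / 10) :=
    ineq261_rescale (h261 (1 / 10 * (1 / 2 - 1 / 10)) (by norm_num) (by norm_num))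
  -- `c₁ > 0` at these pairs (non-empty 𝔅)
  have hc₂ : 0 < B6.c1 d δ₀ (1 / 100) := c1_pos_of_ineq261 h261β y₀ (hrefl y₀)
  have hc' : 0 < B6.c1 d (9 / 50 * δ₀) (1 / 100) := c1_pos_of_ineq261 h261' y₀ (hrefl y₀)
  have hc'' : 0 < B6.c1 d (33 / 100 * δ₀) (1 / 100) := c1_pos_of_ineq261 h261'' y₀ (hrefl y₀)
  have hcc' : 0 < B6.c1 d (49 / 50 * δ₀) (1 / 100) := c1_pos_of_ineq261 h261c y₀ (hrefl y₀)
  have hc₁v : 0 < B6.c1 d δ₀ (1 / 2 + 1 / 10) := c1_pos_of_ineq261 h261v y₀ (hrefl y₀)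
  have hc₁v' : 0 < B6.c1 d ((1 / 2 - 1 / 10) * δ₀) (1 / 10) := c1_pos_of_ineq261 h261v' y₀ (hrefl y₀)
  -- the 24 linear side conditions of the cascade
  have hr : 9 / 50 * δ₀ + (1 / 100 + 1 / 100) * δ₀ ≤ 1 / 5 * δ₀ := by linarith only [hδ₀]
  have hrP : 1 / 5 * δ₀ + 2 * ((1 / 100 + 1 / 100) * δ₀) ≤ 1 / 4 * δ₀ := by linarith only [hδ₀]
  have hrG : 1 / 4 * δ₀ + (2 * (1 / 100) + 1 / 100) * δ₀ ≤ 7 / 20 * δ₀ := by linarith only [hδ₀]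
  have hr1 : 33 / 100 * δ₀ + (1 / 100 + 1 / 100) * δ₀ ≤ 7 / 20 * δ₀ := by linarith only [hδ₀]
  have hr368 : 1 / 4 * δ₀ + 2 * ((2 * (1 / 100) + 1 / 100) * δ₀) ≤ B9Ineq368Vprime.rateC (1 / 100) (33 / 100 * δ₀) := by
    unfold B9Ineq368Vprime.rateC; linarith only [hδ₀]
  have hrc1 : 49 / 50 * δ₀ + (1 / 100 + 1 / 100) * δ₀ ≤ δ₀ := by linarith only [hδ₀]
  have hrc : δ₀ / 2 + (1 / 100 + 1 / 100) * δ₀ ≤ (1 - 1 / 100) * (49 / 50 * δ₀) := by linarith only [hδ₀]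
  have hrcG : 7 / 20 * δ₀ + (1 / 100 + 1 / 100) * δ₀ ≤ (1 - 1 / 100) * (49 / 50 * δ₀) := by linarith only [hδ₀]
  have hGδ1 : 7 / 20 * δ₀ ≤ δ₀ := by linarith only [hδ₀]
  have hrCinv : 7 / 20 * δ₀ ≤ (1 - 1 / 10) * ((1 / 2 - 1 / 10) * δ₀) := by linarith only [hδ₀]
  have hρ0 : 0 ≤ 9 / 50 * δ₀ := by linarith only [hδ₀]
  have hδ5 : 0 ≤ 1 / 5 * δ₀ := by linarith only [hδ₀]
  have hρ₁0 : 0 ≤ 33 / 100 * δ₀ := by linarith only [hδ₀]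
  have hρc0 : 0 ≤ 49 / 50 * δ₀ := by linarith only [hδ₀]
  have hα''ρ : 0 ≤ (1 - 1 / 100) * (33 / 100 * δ₀) := by linarith only [hδ₀]
  have hα''ρ2 : 0 ≤ (1 - 2 * (1 / 100)) * (33 / 100 * δ₀) := by linarith only [hδ₀]
  have hα''ρ3 : 0 ≤ (1 - 3 * (1 / 100)) * (33 / 100 * δ₀) := by linarith only [hδ₀]
  have hα'ρ0 : 0 ≤ 1 / 100 * (9 / 50 * δ₀) := by linarith only [hδ₀]
  have hα'ρ2 : 0 ≤ (1 - 2 * (1 / 100)) * (9 / 50 * δ₀) := by linarith only [hδ₀]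
  have hrb : 1 / 5 * δ₀ + (1 / 100 + 1 / 100) * δ₀ ≤ δ₀ := by linarith only [hδ₀]
  have hΛρ2 : 1 ≤ Λρ ^ 2 := one_le_pow₀ hΛρ1
  have hB₀c : 0 ≤ B₀ * B6.c1 d (9 / 50 * δ₀) (1 / 100) := mul_nonneg hB₀ hc'.le
  have hB2 : B₀ * B6.c1 d (9 / 50 * δ₀) (1 / 100) * 2 ≤ 2 * B₀ * Λρ ^ 2 * B6.c1 d (9 / 50 * δ₀) (1 / 100) :=
    calc B₀ * B6.c1 d (9 / 50 * δ₀) (1 / 100) * 2 = 2 * (B₀ * B6.c1 d (9 / 50 * δ₀) (1 / 100)) * 1 := by ring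
      _ ≤ 2 * (B₀ * B6.c1 d (9 / 50 * δ₀) (1 / 100)) * Λρ ^ 2 := mul_le_mul_of_nonneg_left hΛρ2 (mul_nonneg zero_le_two hB₀c)
      _ = 2 * B₀ * Λρ ^ 2 * B6.c1 d (9 / 50 * δ₀) (1 / 100) := by ring
  have hB3 : B₀ * Λρ ^ 2 * B6.c1 d (9 / 50 * δ₀) (1 / 100) * 2 ≤ 2 * B₀ * Λρ ^ 2 * B6.c1 d (9 / 50 * δ₀) (1 / 100) := le_of_eq (by ring)
  have hmε₁ : min (min (min ε₁ ε₂) (min ε₃ ε₄)) (min ε₅ (1 / 2)) ≤ ε₁ := (min_le_left _ _).trans ((min_le_left _ _).trans (min_le_left _ _))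
  have hmε₂ : min (min (min ε₁ ε₂) (min ε₃ ε₄)) (min ε₅ (1 / 2)) ≤ ε₂ := (min_le_left _ _).trans ((min_le_left _ _).trans (min_le_right _ _))
  have hmε₃ : min (min (min ε₁ ε₂) (min ε₃ ε₄)) (min ε₅ (1 / 2)) ≤ ε₃ := (min_le_left _ _).trans ((min_le_right _ _).trans (min_le_left _ _))
  have hmε₄ : min (min (min ε₁ ε₂) (min ε₃ ε₄)) (min ε₅ (1 / 2)) ≤ ε₄ := (min_le_left _ _).trans ((min_le_right _ _).trans (min_le_right _ _))
  have hmε₅ : min (min (min ε₁ ε₂) (min ε₃ ε₄)) (min ε₅ (1 / 2)) ≤ ε₅ := (min_le_right _ _).trans (min_le_left _ _)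
  have hmh : min (min (min ε₁ ε₂) (min ε₃ ε₄)) (min ε₅ (1 / 2)) ≤ 1 / 2 := (min_le_right _ _).trans (min_le_right _ _)
  have habs : |α₁| = α₁ := abs_of_nonneg hα₁0
  have h1 : theta363 (Fintype.card κ) 1 α₁ a₀ Cq M₂ (∑ i, ‖b i‖) (Real.exp (δ₀ * d₀)) BG Λ (B6.c1 d δ₀ (1 / 100)) * B6.c1 d (49 / 50 * δ₀) (1 / 100) < 1 / 2 := hF1 α₁ (by rw [habs]; linarith only [hα₁1, hmε₁, hε₁])
  have h2 : theta363 (Fintype.card κ) 1 α₁ a₀ Cq M₂ (∑ i, ‖b i‖) (Real.exp (7 / 20 * δ₀ * d₀)) BG Λ (B6.c1 d δ₀ (1 / 100)) * B6.c1 d (33 / 100 * δ₀) (1 / 100) < 1 / 2 := hF2 α₁ (by rw [habs]; linarith only [hα₁1, hmε₂, hε₂])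
  have h3 : thetaL363 (Fintype.card κ) 1 α₁ a₀ Cq M₂ (∑ i, ‖b i‖) (Real.exp (7 / 20 * δ₀ * d₀)) BG Λ (B6.c1 d δ₀ (1 / 100)) * B6.c1 d (33 / 100 * δ₀) (1 / 100) < 1 / 2 := hF3 α₁ (by rw [habs]; linarith only [hα₁1, hmε₃, hε₃])
  have h4 : kappa385 B₀ (cV385 (Fintype.card κ) α₁ C₀ ((M₂ * ∑ i, ‖b i‖) * Real.exp (1 / 5 * δ₀ * d₀)) + ∑ _k : κ ⊕ κ, (10 + 8 * ↑(Fintype.card κ) + (16 * ↑(Fintype.card κ) + 12) * C₀) * ((M₂ * ∑ i, ‖b i‖) * Real.exp (1 / 5 * δ₀ * d₀))) (kappa377 (4 * (1 + ↑(Fintype.card κ)) * (M₂ * ∑ i, ‖b i‖) * Real.exp (1 / 4 * δ₀ * d₀)) (kappa349 κQ ((1 + ↑(Fintype.card κ)) * BG) B₁ Λ (B6.c1 d δ₀ (1 / 100))) (kappa368 κQ cF (kappa385 1 (cVConc (Fintype.card κ) 1 α₁ a₀ Cq M₂ (∑ i, ‖b i‖) (Real.exp (7 / 20 * δ₀ *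 d₀))) 0 0 Λ (B6.c1 d δ₀ (1 / 100))) (kappa366 κQ cF (kappa385 1 (cVConc (Fintype.card κ) 1 α₁ a₀ Cq M₂ (∑ i, ‖b i‖) (Real.exp (δ₀ * d₀))) 0 0 Λ (B6.c1 d δ₀ (1 / 100))) BG (BG * B6.c1 d (49 / 50 * δ₀) (1 / 100) * (1 - theta363 (Fintype.card κ) 1 α₁ a₀ Cq M₂ (∑ i, ‖b i‖) (Real.exp (δ₀ * d₀)) BG Λ (B6.c1 d δ₀ (1 / 100)) * B6.c1 d (49 / 50 * δ₀) (1 / 100))⁻¹) Λ (B6.c1 d δ₀ (1 / 100)) α₁) BG BG (BG * B6.c1 d (33 / 100 * δ₀) (1 / 100) * (1 - theta363 (Fintype.card κ) 1 α₁ a₀ Cq M₂ (∑ i, ‖b i‖) (Real.exp (7 / 20 * δ₀ * d₀)) BG Λ (B6.c1 d δ₀ (1 / 100)) * B6.c1 d (33 / 100 * δ₀) (1 / 100))⁻¹) B₁ (2 * B₁ * B6.c1 d ((1 / 2 - 1 / 10) * δ₀) (1 / 10)) Λ (B6.c1 d δ₀ (1 / 100)) α₁ + ↑(Fintype.card κ)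 * kappa368Ds κQ cF (kappa385 BG (cVConc (Fintype.card κ) 1 α₁ a₀ Cq M₂ (∑ i, ‖b i‖) (Real.exp (7 / 20 * δ₀ * d₀))) 0 0 Λ (B6.c1 d δ₀ (1 / 100))) (kappa366 κQ cF (kappa385 1 (cVConc (Fintype.card κ) 1 α₁ a₀ Cq M₂ (∑ i, ‖b i‖) (Real.exp (δ₀ * d₀))) 0 0 Λ (B6.c1 d δ₀ (1 / 100))) BG (BG * B6.c1 d (49 / 50 * δ₀) (1 / 100) * (1 - theta363 (Fintype.card κ) 1 α₁ a₀ Cq M₂ (∑ i, ‖b i‖) (Real.exp (δ₀ * d₀)) BG Λ (B6.c1 d δ₀ (1 / 100)) * B6.c1 d (49 / 50 * δ₀) (1 / 100))⁻¹) Λ (B6.c1 d δ₀ (1 / 100)) α₁) BG BG BG (B6.c1 d (33 / 100 * δ₀) (1 / 100) * (1 - theta363 (Fintype.card κ) 1 α₁ a₀ Cq M₂ (∑ i, ‖b i‖) (Real.exp (7 / 20 * δ₀ * d₀)) BG Λ (B6.c1 d δ₀ (1 / 100)) * B6.c1 d (33 / 100 * δ₀) (1 / 100))⁻¹) (BG *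 Λρ₁ ^ 2 * B6.c1 d (33 / 100 * δ₀) (1 / 100) * (1 - thetaL363 (Fintype.card κ) 1 α₁ a₀ Cq M₂ (∑ i, ‖b i‖) (Real.exp (7 / 20 * δ₀ * d₀)) BG Λ (B6.c1 d δ₀ (1 / 100)) * B6.c1 d (33 / 100 * δ₀) (1 / 100))⁻¹) B₁ (2 * B₁ * B6.c1 d ((1 / 2 - 1 / 10) * δ₀) (1 / 10)) (cBConc (Fintype.card κ) M₂ (∑ i, ‖b i‖) (Real.exp (B9Ineq368Vprime.rateC (1 / 100) (33 / 100 * δ₀) * d₀))) (cCConc (Fintype.card κ) 1 α₁ a₀ Cq M₂ (∑ i, ‖b i‖) (Real.exp (B9Ineq368Vprime.rateC (1 / 100) (33 / 100 * δ₀) * d₀))) Λ (B6.c1 d δ₀ (1 / 100)) α₁) Λ (B6.c1 d δ₀ (1 / 100)) α₁) (kappa383 κQb cFb abar Λ (B6.c1 d δ₀ (1 / 100)) α₁) Λ (B6.c1 d δ₀ (1 / 100)) * α₁ * B6.c1 d (9 / 50 * δ₀) (1 / 100) < 1 / 2 :=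
    hF4 α₁ (by rw [habs]; linarith only [hα₁1, hmε₄, hε₄])
  have h5 : α₁ * (2 * (kappa366 κQ cF (kappa385 1 (cVConc (Fintype.card κ) 1 α₁ a₀ Cq M₂ (∑ i, ‖b i‖) (Real.exp (δ₀ * d₀))) 0 0 Λ (B6.c1 d δ₀ (1 / 100))) BG (BG * B6.c1 d (49 / 50 * δ₀) (1 / 100) * (1 - theta363 (Fintype.card κ) 1 α₁ a₀ Cq M₂ (∑ i, ‖b i‖) (Real.exp (δ₀ * d₀)) BG Λ (B6.c1 d δ₀ (1 / 100)) * B6.c1 d (49 / 50 * δ₀) (1 / 100))⁻¹) Λ (B6.c1 d δ₀ (1 / 100)) α₁ * B₁ * c₄ * B6.c1 d δ₀ (1 / 2 + 1 / 10)) * B6.c1 d ((1 / 2 - 1 / 10) * δ₀) (1 / 10)) < 1 / 2 :=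
    hF5 α₁ (by rw [habs]; linarith only [hα₁1, hmε₅, hε₅])
  have hhalf : (1 / 2 : ℝ) < 1 := by norm_num
  -- `η·α₁(Lʲη)⁻¹ ≦ 1/4` from `α₁ ≦ 1/4` and `η ≦ Lʲη`
  have hsmall : ∀ y : g.Site, g.eta * (α₁ * (g.len y)⁻¹) ≤ 1 / 4 := fun y => by
    have hq : g.eta * (g.len y)⁻¹ ≤ 1 := by
      rw [← div_eq_mul_inv]; exact (div_le_one (hlen y)).mpr (hlenη y)
    calc g.eta * (α₁ * (g.len y)⁻¹) = α₁ * (g.eta * (g.len y)⁻¹) := by ring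
      _ ≤ α₁ * 1 := mul_le_mul_of_nonneg_left hq hα₁0
      _ ≤ 1 / 4 := by linarith only [hα₁1, hmh]
  -- `P₂`'s (3.83) from the (3.15)/(3.80)–(3.81) letters (`B9Ineq385VG.ineq383_op`), delivered at the rate `δ = δ₀/5`
  have hP₂ : HasMajorant (g := toB6 g Rr H) (fun q : (κ × S) × ι => blk q.1.2) P₂
      (fun a a' => kappa383 κQb cFb abar Λ (B6.c1 d δ₀ (1 / 100)) α₁ * α₁ * (g.len a ^ 2)⁻¹ *
        Real.exp (-(1 / 5 * δ₀ * g.dist a a'))) := by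
    rw [hP₂def]
    exact ineq383_op (R := Rr) (H := H) (fun q : (κ × S) × ι => blk q.1.2) d δ₀ δ₀ (1 / 100) (1 / 100) (1 / 5 * δ₀) Λ κQb cFb
      abar α₁ hκQb hcFb habar hα₁0 hΛ0.le hδ5 (by norm_num) (by norm_num) hδ₀.le hrb hdnn htri h261β hT2i
      hQb hQsb hF₂ hF₂s ha324
  -- Theorem 3.3's entries for `G(U)` weakened from the rate `δ₀` to `δ = δ₀/5`
  have hexpδ : ∀ a a' : g.Site, Real.exp (-(δ₀ * g.dist a a')) ≤ Real.exp (-(1 / 5 * δ₀ * g.dist a a')) := fun a a' => by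
    have h0 : 0 ≤ δ₀ * g.dist a a' := mul_nonneg hδ₀.le (hdnn a a')
    exact Real.exp_le_exp.mpr (by linarith only [h0])
  have hGδ : HasMajorant (g := toB6 g Rr H) (fun q : (κ × S) × ι => blk q.1.2) G
      (fun a a' => B₀ * g.len a ^ 2 * Real.exp (-(1 / 5 * δ₀ * g.dist a a'))) :=
    hasMajorant_mono (g := toB6 g Rr H) _ hG fun a a' =>
      mul_le_mul_of_nonneg_left (hexpδ a a') (mul_nonneg hB₀ (sq_nonneg _))
  have hDGδ : ∀ k : κ ⊕ κ, HasMajorant (g := toB6 g Rr H) (fun q : (κ × S) × ι => blk q.1.2)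
      (conj b (diffLetter (bT T) (bU U) ((g.eta : ℂ)⁻¹) k) * G) (fun a a' => B₀ * g.len a * Real.exp (-(1 / 5 * δ₀ * g.dist a a'))) :=
    fun k => hasMajorant_mono (g := toB6 g Rr H) _ (hDG k) fun a a' =>
      mul_le_mul_of_nonneg_left (hexpδ a a') (mul_nonneg hB₀ (hlen a).le)
  have hGDδ : ∀ k : κ ⊕ κ, HasMajorant (g := toB6 g Rr H) (fun q : (κ × S) × ι => blk q.1.2)
      (G * conj b (diffLetter (bT T) (bU U) ((g.eta : ℂ)⁻¹) k)) (fun a a' => B₀ * g.len a * Real.exp (-(1 / 5 * δ₀ * g.dist a a'))) :=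
    fun k => hasMajorant_mono (g := toB6 g Rr H) _ (hGD k) fun a a' =>
      mul_le_mul_of_nonneg_left (hexpδ a a') (mul_nonneg hB₀ (hlen a).le)
  -- signs of the explicit constants at this `α₁`
  have hκ₂0 : 0 ≤ kappa383 κQb cFb abar Λ (B6.c1 d δ₀ (1 / 100)) α₁ := kappa383_nonneg hκQb hcFb habar hΛ0.le hc₂.le hα₁0
  have hcV0E : ∀ E : ℝ, 0 ≤ E →
      0 ≤ kappa385 1 (cVConc (Fintype.card κ) 1 α₁ a₀ Cq M₂ (∑ i, ‖b i‖) E) 0 0 Λ (B6.c1 d δ₀ (1 / 100)) := fun E hE =>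
    kappa385_nonneg zero_le_one (cVConc_nonneg hα₁0 ha₀ hCq hM₂ hSb hE) le_rfl le_rfl hΛ0.le hc₂.le
  have hcV0G : 0 ≤ kappa385 BG (cVConc (Fintype.card κ) 1 α₁ a₀ Cq M₂ (∑ i, ‖b i‖) (Real.exp (7 / 20 * δ₀ * d₀))) 0 0 Λ (B6.c1 d δ₀ (1 / 100)) :=
    kappa385_nonneg hBG.le (cVConc_nonneg hα₁0 ha₀ hCq hM₂ hSb (Real.exp_nonneg _)) le_rfl le_rfl hΛ0.le hc₂.le
  have hNc : 0 < BG * B6.c1 d (49 / 50 * δ₀) (1 / 100) * (1 - theta363 (Fintype.card κ) 1 α₁ a₀ Cq M₂ (∑ i, ‖b i‖) (Real.exp (δ₀ * d₀)) BG Λ (B6.c1 d δ₀ (1 / 100)) * B6.c1 d (49 / 50 * δ₀) (1 / 100))⁻¹ :=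
    mul_pos (mul_pos hBG hcc') (inv_pos.mpr (by linarith only [h1]))
  have hN'' : 0 ≤ BG * B6.c1 d (33 / 100 * δ₀) (1 / 100) * (1 - theta363 (Fintype.card κ) 1 α₁ a₀ Cq M₂ (∑ i, ‖b i‖) (Real.exp (7 / 20 * δ₀ * d₀)) BG Λ (B6.c1 d δ₀ (1 / 100)) * B6.c1 d (33 / 100 * δ₀) (1 / 100))⁻¹ :=
    mul_nonneg (mul_nonneg hBG.le hc''.le) (inv_nonneg.mpr (by linarith only [h2]))
  have hN3 : 0 ≤ B6.c1 d (33 / 100 * δ₀) (1 / 100) * (1 - theta363 (Fintype.card κ) 1 α₁ a₀ Cq M₂ (∑ i, ‖b i‖) (Real.exp (7 / 20 * δ₀ * d₀)) BG Λ (B6.c1 d δ₀ (1 / 100)) * B6.c1 d (33 / 100 * δ₀) (1 / 100))⁻¹ :=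
    mul_nonneg hc''.le (inv_nonneg.mpr (by linarith only [h2]))
  have hN3L : 0 ≤ BG * Λρ₁ ^ 2 * B6.c1 d (33 / 100 * δ₀) (1 / 100) * (1 - thetaL363 (Fintype.card κ) 1 α₁ a₀ Cq M₂ (∑ i, ‖b i‖) (Real.exp (7 / 20 * δ₀ * d₀)) BG Λ (B6.c1 d δ₀ (1 / 100)) * B6.c1 d (33 / 100 * δ₀) (1 / 100))⁻¹ :=
    mul_nonneg (mul_nonneg (mul_nonneg hBG.le (sq_nonneg Λρ₁)) hc''.le) (inv_nonneg.mpr (by linarith only [h3]))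
  have hκC0 : 0 < kappa366 κQ cF (kappa385 1 (cVConc (Fintype.card κ) 1 α₁ a₀ Cq M₂ (∑ i, ‖b i‖) (Real.exp (δ₀ * d₀))) 0 0 Λ (B6.c1 d δ₀ (1 / 100))) BG (BG * B6.c1 d (49 / 50 * δ₀) (1 / 100) * (1 - theta363 (Fintype.card κ) 1 α₁ a₀ Cq M₂ (∑ i, ‖b i‖) (Real.exp (δ₀ * d₀)) BG Λ (B6.c1 d δ₀ (1 / 100)) * B6.c1 d (49 / 50 * δ₀) (1 / 100))⁻¹) Λ (B6.c1 d δ₀ (1 / 100)) α₁ :=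
    kappa366_pos hκQ hcF (hcV0E _ (Real.exp_nonneg _)) hNc hΛ0 hc₂ hα₁0
  have hBc0 : 0 ≤ 2 * B₁ * B6.c1 d ((1 / 2 - 1 / 10) * δ₀) (1 / 10) := mul_nonneg (mul_nonneg zero_le_two hB₁.le) hc₁v'.le
  have hK1nn : 0 ≤ kappa368 κQ cF (kappa385 1 (cVConc (Fintype.card κ) 1 α₁ a₀ Cq M₂ (∑ i, ‖b i‖) (Real.exp (7 / 20 * δ₀ * d₀))) 0 0 Λ (B6.c1 d δ₀ (1 / 100))) (kappa366 κQ cF (kappa385 1 (cVConc (Fintype.card κ) 1 α₁ a₀ Cq M₂ (∑ i, ‖b i‖) (Real.exp (δ₀ * d₀))) 0 0 Λ (B6.c1 d δ₀ (1 / 100))) BG (BG * B6.c1 d (49 / 50 * δ₀) (1 / 100) * (1 - theta363 (Fintype.card κ) 1 α₁ a₀ Cq M₂ (∑ i, ‖b i‖) (Real.exp (δ₀ * d₀)) BG Λ (B6.c1 d δ₀ (1 / 100)) * B6.c1 d (49 / 50 * δ₀) (1 / 100))⁻¹) Λ (B6.c1 d δ₀ (1 / 100)) α₁) BG BG (BG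 * B6.c1 d (33 / 100 * δ₀) (1 / 100) * (1 - theta363 (Fintype.card κ) 1 α₁ a₀ Cq M₂ (∑ i, ‖b i‖) (Real.exp (7 / 20 * δ₀ * d₀)) BG Λ (B6.c1 d δ₀ (1 / 100)) * B6.c1 d (33 / 100 * δ₀) (1 / 100))⁻¹) B₁ (2 * B₁ * B6.c1 d ((1 / 2 - 1 / 10) * δ₀) (1 / 10)) Λ (B6.c1 d δ₀ (1 / 100)) α₁ :=
    kappa368_nonneg hκQ.le hcF.le (hcV0E _ (Real.exp_nonneg _)) hκC0.le hBG.le hBG.le hN'' hB₁.le hBc0 hc₂.le hα₁0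
  have hcB : 0 ≤ cBConc (Fintype.card κ) M₂ (∑ i, ‖b i‖) (Real.exp (B9Ineq368Vprime.rateC (1 / 100) (33 / 100 * δ₀) * d₀)) := by
    unfold cBConc
    exact mul_nonneg (mul_nonneg zero_le_two (Nat.cast_nonneg _))
      (mul_nonneg (mul_nonneg (mul_nonneg zero_le_two hM₂) hSb) (Real.exp_nonneg _))
  have hcC : 0 ≤ cCConc (Fintype.card κ) 1 α₁ a₀ Cq M₂ (∑ i, ‖b i‖)
      (Real.exp (B9Ineq368Vprime.rateC (1 / 100) (33 / 100 * δ₀) * d₀)) := by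
    unfold cCConc
    have i0 : 0 ≤ 2 + Cq * α₁ := by have := mul_nonneg hCq hα₁0; linarith only [this]
    have i1 : 0 ≤ (2 + 8 * (1 : ℝ) ^ 2 * α₁) * (Fintype.card κ : ℝ) := mul_nonneg (by linarith only [hα₁0]) (Nat.cast_nonneg _)
    have i2 : 0 ≤ a₀ * Cq * (2 + Cq * α₁) := mul_nonneg (mul_nonneg ha₀ hCq) i0
    have i3 : 0 ≤ 4 * (Fintype.card κ : ℝ) * (1 : ℝ) ^ 2 := by positivity
    exact mul_nonneg (mul_nonneg (mul_nonneg (add_nonneg (add_nonneg i1 i2) i3) hM₂) hSb) (Real.exp_nonneg _)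
  have hK3nn : 0 ≤ ↑(Fintype.card κ) * kappa368Ds κQ cF (kappa385 BG (cVConc (Fintype.card κ) 1 α₁ a₀ Cq M₂ (∑ i, ‖b i‖) (Real.exp (7 / 20 * δ₀ * d₀))) 0 0 Λ (B6.c1 d δ₀ (1 / 100))) (kappa366 κQ cF (kappa385 1 (cVConc (Fintype.card κ) 1 α₁ a₀ Cq M₂ (∑ i, ‖b i‖) (Real.exp (δ₀ * d₀))) 0 0 Λ (B6.c1 d δ₀ (1 / 100))) BG (BG * B6.c1 d (49 / 50 * δ₀) (1 / 100) * (1 - theta363 (Fintype.card κ) 1 α₁ a₀ Cq M₂ (∑ i, ‖b i‖) (Real.exp (δ₀ * d₀)) BG Λ (B6.c1 d δ₀ (1 / 100)) * B6.c1 d (49 / 50 * δ₀) (1 / 100))⁻¹) Λ (B6.c1 d δ₀ (1 / 100)) α₁) BG BG BG (B6.c1 d (33 / 100 * δ₀) (1 / 100) * (1 - theta363 (Fintype.card κ) 1 α₁ a₀ Cq M₂ (∑ i, ‖b i‖) (Real.exp (7 / 20 * δ₀ * d₀)) BG Λ (B6.c1 d δ₀ (1 / 100)) * B6.c1 d (33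 / 100 * δ₀) (1 / 100))⁻¹) (BG * Λρ₁ ^ 2 * B6.c1 d (33 / 100 * δ₀) (1 / 100) * (1 - thetaL363 (Fintype.card κ) 1 α₁ a₀ Cq M₂ (∑ i, ‖b i‖) (Real.exp (7 / 20 * δ₀ * d₀)) BG Λ (B6.c1 d δ₀ (1 / 100)) * B6.c1 d (33 / 100 * δ₀) (1 / 100))⁻¹) B₁ (2 * B₁ * B6.c1 d ((1 / 2 - 1 / 10) * δ₀) (1 / 10)) (cBConc (Fintype.card κ) M₂ (∑ i, ‖b i‖) (Real.exp (B9Ineq368Vprime.rateC (1 / 100) (33 / 100 * δ₀) * d₀))) (cCConc (Fintype.card κ) 1 α₁ a₀ Cq M₂ (∑ i, ‖b i‖) (Real.exp (B9Ineq368Vprime.rateC (1 / 100) (33 / 100 * δ₀) * d₀))) Λ (B6.c1 d δ₀ (1 / 100)) α₁ :=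
    mul_nonneg (Nat.cast_nonneg _) (kappa368Ds_nonneg hκQ.le hcF.le hcV0G hκC0.le hBG.le hBG.le hBG.le hN3 hN3L hB₁.le hBc0
      hcB hcC hc₂.le hα₁0)
  have hXpos : 0 < 2 * (kappa366 κQ cF (kappa385 1 (cVConc (Fintype.card κ) 1 α₁ a₀ Cq M₂ (∑ i, ‖b i‖) (Real.exp (δ₀ * d₀))) 0 0 Λ (B6.c1 d δ₀ (1 / 100))) BG (BG * B6.c1 d (49 / 50 * δ₀) (1 / 100) * (1 - theta363 (Fintype.card κ) 1 α₁ a₀ Cq M₂ (∑ i, ‖b i‖) (Real.exp (δ₀ * d₀)) BG Λ (B6.c1 d δ₀ (1 / 100)) * B6.c1 d (49 / 50 * δ₀) (1 / 100))⁻¹) Λ (B6.c1 d δ₀ (1 / 100)) α₁ * B₁ * c₄ * B6.c1 d δ₀ (1 / 2 + 1 / 10)) * B6.c1 d ((1 / 2 - 1 / 10) * δ₀) (1 / 10) :=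
    mul_pos (mul_pos two_pos (mul_pos (mul_pos (mul_pos hκC0 hB₁) hc₄) hc₁v)) hc₁v'
  have ha₁' : α₁ ≤ (2 * (kappa366 κQ cF (kappa385 1 (cVConc (Fintype.card κ) 1 α₁ a₀ Cq M₂ (∑ i, ‖b i‖) (Real.exp (δ₀ * d₀))) 0 0 Λ (B6.c1 d δ₀ (1 / 100))) BG (BG * B6.c1 d (49 / 50 * δ₀) (1 / 100) * (1 - theta363 (Fintype.card κ) 1 α₁ a₀ Cq M₂ (∑ i, ‖b i‖) (Real.exp (δ₀ * d₀)) BG Λ (B6.c1 d δ₀ (1 / 100)) * B6.c1 d (49 / 50 * δ₀) (1 / 100))⁻¹) Λ (B6.c1 d δ₀ (1 / 100)) α₁ * B₁ * c₄ * B6.c1 d δ₀ (1 / 2 + 1 / 10)) * B6.c1 d ((1 / 2 - 1 / 10) * δ₀) (1 / 10))⁻¹ := by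
    rw [inv_eq_one_div, le_div_iff₀ hXpos]; linarith only [h5]
  -- FILE 19 with the cascade, the explicit constants and the thresholds
  obtain ⟨Tinv, GExt, e1, e2, e3, e4, hLc, hRc⟩ := thm34_G_clause_concreteC (Rr := Rr) (H := H) b T U blk d
    δ₀ (1 / 5 * δ₀) (1 / 4 * δ₀) (7 / 20 * δ₀) δ₀ (49 / 50 * δ₀) (1 / 100) (1 / 10) (1 / 10) c₄ (1 / 100) (1 / 100) (9 / 50 * δ₀)
    (1 / 100) (33 / 100 * δ₀) (1 / 100) Λ Λρ Λρ₁ B₀ κQ BG B₁ _ _ cF Cq a₀ _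
    (kappa368 κQ cF (kappa385 1 (cVConc (Fintype.card κ) 1 α₁ a₀ Cq M₂ (∑ i, ‖b i‖) (Real.exp (7 / 20 * δ₀ * d₀))) 0 0 Λ (B6.c1 d δ₀ (1 / 100))) (kappa366 κQ cF (kappa385 1 (cVConc (Fintype.card κ) 1 α₁ a₀ Cq M₂ (∑ i, ‖b i‖) (Real.exp (δ₀ * d₀))) 0 0 Λ (B6.c1 d δ₀ (1 / 100))) BG (BG * B6.c1 d (49 / 50 * δ₀) (1 / 100) * (1 - theta363 (Fintype.card κ) 1 α₁ a₀ Cq M₂ (∑ i, ‖b i‖) (Real.exp (δ₀ * d₀)) BG Λ (B6.c1 d δ₀ (1 / 100)) * B6.c1 d (49 / 50 * δ₀) (1 / 100))⁻¹) Λ (B6.c1 d δ₀ (1 / 100)) α₁) BG BG (BG * B6.c1 d (33 / 100 * δ₀) (1 / 100) * (1 - theta363 (Fintype.card κ) 1 α₁ a₀ Cq M₂ (∑ i, ‖b i‖) (Real.exp (7 / 20 * δ₀ * d₀)) BG Λ (B6.c1 d δ₀ (1 / 100)) * B6.c1 d (33 / 100 * δ₀) (1 / 100))⁻¹) B₁ (2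 * B₁ * B6.c1 d ((1 / 2 - 1 / 10) * δ₀) (1 / 10)) Λ (B6.c1 d δ₀ (1 / 100)) α₁ + ↑(Fintype.card κ) * kappa368Ds κQ cF (kappa385 BG (cVConc (Fintype.card κ) 1 α₁ a₀ Cq M₂ (∑ i, ‖b i‖) (Real.exp (7 / 20 * δ₀ * d₀))) 0 0 Λ (B6.c1 d δ₀ (1 / 100))) (kappa366 κQ cF (kappa385 1 (cVConc (Fintype.card κ) 1 α₁ a₀ Cq M₂ (∑ i, ‖b i‖) (Real.exp (δ₀ * d₀))) 0 0 Λ (B6.c1 d δ₀ (1 / 100))) BG (BG * B6.c1 d (49 / 50 * δ₀) (1 / 100) * (1 - theta363 (Fintype.card κ) 1 α₁ a₀ Cq M₂ (∑ i, ‖b i‖) (Real.exp (δ₀ * d₀)) BG Λ (B6.c1 d δ₀ (1 / 100)) * B6.c1 d (49 / 50 * δ₀) (1 / 100))⁻¹) Λ (B6.c1 d δ₀ (1 / 100)) α₁) BG BG BG (B6.c1 d (33 / 100 * δ₀) (1 / 100) * (1 - theta363 (Fintype.card κ) 1 α₁ a₀ Cq M₂ (∑ i, ‖b i‖) (Real.exp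 (7 / 20 * δ₀ * d₀)) BG Λ (B6.c1 d δ₀ (1 / 100)) * B6.c1 d (33 / 100 * δ₀) (1 / 100))⁻¹) (BG * Λρ₁ ^ 2 * B6.c1 d (33 / 100 * δ₀) (1 / 100) * (1 - thetaL363 (Fintype.card κ) 1 α₁ a₀ Cq M₂ (∑ i, ‖b i‖) (Real.exp (7 / 20 * δ₀ * d₀)) BG Λ (B6.c1 d δ₀ (1 / 100)) * B6.c1 d (33 / 100 * δ₀) (1 / 100))⁻¹) B₁ (2 * B₁ * B6.c1 d ((1 / 2 - 1 / 10) * δ₀) (1 / 10)) (cBConc (Fintype.card κ) M₂ (∑ i, ‖b i‖) (Real.exp (B9Ineq368Vprime.rateC (1 / 100) (33 / 100 * δ₀) * d₀))) (cCConc (Fintype.card κ) 1 α₁ a₀ Cq M₂ (∑ i, ‖b i‖) (Real.exp (B9Ineq368Vprime.rateC (1 / 100) (33 / 100 * δ₀) * d₀))) Λ (B6.c1 d δ₀ (1 / 100)) α₁)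
    _ (kappa383 κQb cFb abar Λ (B6.c1 d δ₀ (1 / 100)) α₁) α₁ C₀ d₀ M₂ kQ kF sQ sF cfun w
    hB₀ hκQ hBG hB₁ hcF hCq ha₀ (add_nonneg hK1nn hK3nn) hκ₂0 hα₁0 hC₀ hΛ hΛρ hρ0 (by norm_num) (by norm_num) hδ₀
    hδ5 hM₂ hr hrP hrG hr1 (by norm_num) (by norm_num) hρ₁0 hα''ρ hα''ρ2 hα''ρ3 hΛρ₁
    hr368 hrc1 hρc0 (by norm_num) (by norm_num) hrc hrcG hGδ1 hGδ1 (by norm_num) (by norm_num) (by norm_num) hc₄ hrCinv hc₁v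
    hc₁v' hc₂ hcc' rfl rfl ha₁' rfl (by norm_num) hα'ρ0 hα'ρ2 rfl hdnn htri hrefl hsym hlen h261β h261' h261''
    h261c h261v h261v' hT1 hT2 hT1i hT2i hT4 hTρ hTρ₁ hT4v (h4.trans hhalf) hrepr hη hL A hT hsmall hU1 h337B h337F h337B' h337Bτ
    h337FB hA hAτB hAτF hAFB hAst hAloc hdAst h35 hd₀B hd₀F hd₀FB hd₀st hd₀loc hd₀0 h342_1 h342_2 h342_3 rep hrep h357 h357s
    hQc hQcs hFc hFcs hLinv h348 (h1.trans hhalf) hw hcard hkQ hkF hsQ hsF hcfun (h2.trans hhalf) (h3.trans hhalf)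
    (le_add_of_nonneg_right hK3nn) (le_add_of_nonneg_left hK1nn) h380 h380s hP₂def hΔG hGΔ hP₂ hGδ hDGδ hGDδ
  -- the conclusions, with the output majorants weakened to the `α₁`-free constant `B` and the rate `δ₀/6`
  refine ⟨Tinv, GExt, e1, e2, e3, e4, fun X P hP0 hXG => ?_, fun Y hGY => ?_⟩
  · have hXGδ : HasMajorant (g := toB6 g Rr H) (fun q : (κ × S) × ι => blk q.1.2) (X * G)
        (fun a a' => B₀ * P a * Real.exp (-(1 / 5 * δ₀ * g.dist a a'))) :=
      hasMajorant_mono (g := toB6 g Rr H) _ hXG fun a a' => mul_le_mul_of_nonneg_left (hexpδ a a') (mul_nonneg hB₀ (hP0 a))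
    refine hasMajorant_mono (g := toB6 g Rr H) _ (hLc X P hP0 hXGδ) fun a a' => ?_
    have h0 : 0 ≤ δ₀ * g.dist a a' := mul_nonneg hδ₀.le (hdnn a a')
    have hexp6 : Real.exp (-((1 - 1 / 100) * (9 / 50 * δ₀) * g.dist a a')) ≤ Real.exp (-(δ₀ / 6 * g.dist a a')) :=
      Real.exp_le_exp.mpr (by linarith only [h0])
    exact mul_le_mul (mul_le_mul_of_nonneg_right ((mul_le_mul_of_nonneg_left (neumann_le_two h4) hB₀c).trans hB2) (hP0 a))
      hexp6 (Real.exp_pos _).le (mul_nonneg hBnn (hP0 a))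
  · have hGYδ : HasMajorant (g := toB6 g Rr H) (fun q : (κ × S) × ι => blk q.1.2) (G * Y)
        (fun a a' => B₀ * g.len a * Real.exp (-(1 / 5 * δ₀ * g.dist a a'))) :=
      hasMajorant_mono (g := toB6 g Rr H) _ hGY fun a a' => mul_le_mul_of_nonneg_left (hexpδ a a') (mul_nonneg hB₀ (hlen a).le)
    refine hasMajorant_mono (g := toB6 g Rr H) _ (hRc Y hGYδ) fun a a' => ?_
    have h0 : 0 ≤ δ₀ * g.dist a a' := mul_nonneg hδ₀.le (hdnn a a')
    have hexp6 : Real.exp (-((1 - 3 * (1 / 100)) * (9 / 50 * δ₀) * g.dist a a')) ≤ Real.exp (-(δ₀ / 6 * g.dist a a')) :=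
      Real.exp_le_exp.mpr (by linarith only [h0])
    exact mul_le_mul (mul_le_mul_of_nonneg_right
      ((mul_le_mul_of_nonneg_left (neumann_le_two h4) (mul_nonneg (mul_nonneg hB₀ (sq_nonneg Λρ)) hc'.le)).trans hB3) (hlen a).le)
      hexp6 (Real.exp_pos _).le (mul_nonneg hBnn (hlen a).le)

end Uniform

end Literature.MathematicalPhysics.QuantumFieldTheory.Balaban1983to89.B9Thm34GUniform

end
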